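/-
Copyright (c) 2026 the pub-hodgecm-mathlib formalisation cell (harness21).  Prover seat hodgecm-mathlib-F0P3a-p08 (g19): «S3-ram» seeding wave (LEAD F0P3a-plan (g12), owner
F0P3a-p06 (g15)), row (e2)(b) «[T2-c]-ram» (A-p19 (g26) PLAN-T2c-ram-layer3, inherited 22:13:38Z), LAYER 3 brick (ii-c): the DEFECTIVE DESCENT assembled — `[Λ^⋆ : R^⋆]`; 2026-09-01.
-/
import Literature.NumberTheory.Automorphic.QuadraticUnramifiedOrderAntiFixedDefect       -- ★ p847012 (this seat) (ii-a): `[R⁻ : ΠR^⋆] = #𝓀_E`, `exists_inv_coord_of_mem_range`, `star_const`, `star_inv_gen`, `inv_gen_mem_range_eval₂`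
import Literature.NumberTheory.Automorphic.UnramifiedCoordinateModelAntiFixedTypeB       -- ★ (this seat) (ii-b): type-B defect `#𝓀_F`; brings ★ p846954 (type A, defect 1) and ★ p846944
import Literature.RingTheory.GaloisAlgebras.InvolutionDescentAntiFixed                  -- ★ p846932 (A-p19): `index_mul_relIndex_map_eq_sq_mul` (the defective descent identity)
import HarnessLib

/-!
# The type-(2) order at a TAMELY RAMIFIED base: `[Λ⁻ : Π·Λ^⋆]` on `Λ = 𝒪_E × O₁`, `#𝓀_E = #𝓀_F`, and the fixed additive index `[Λ^⋆ : R^⋆]² = q^{N+n+1}` (type A) ∕ `q^{N+n}` (type B)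
# (Neukirch I §12; Serre, *Local Fields* Ch. I §6, Ch. V §3; Hungerford Ch. I Thm. 4.5)

Topic `NumberTheory/Automorphic`; namespace `Literature.NumberTheory.Automorphic`.  THEOREMS ONLY (no definition, no instance, no notation, no named fact, no `sorry`); (D0)
currency of ★ p846557 ∕ p846912 ∕ p847012.  Cell `pub/hodgecm-mathlib` (D-0151), crux H413 = `stmt-HodgeConjecture-24833`; «S3-ram» row (e2)(b) «[T2-c]-ram» LAYER 3 (A-p19 (g26)
PLAN-T2c-ram-layer3 ∕ CERT «[T2-c]-ram» §2): with ★ p846932 `[Λ : R]·[R⁻ : ΠR^⋆] = [Λ^⋆ : R^⋆]²·[Λ⁻ : ΠΛ^⋆]`, ★ p846557 `[Λ : R] = q_E^{N+n}`, ★ p847012 `[R⁻ : ΠR^⋆] = q_E`, and the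
factorwise defects ★ p846944 (`𝒪_E`: 1), ★ p846954 (`O₁`, type A: 1), ★ (ii-b) (`O₁`, type B: `q_F`), the fixed additive index of the order `R = 𝒪_E[(u, λ)]` in `Λ = 𝒪_E × O₁` is
**`[Λ^⋆ : R^⋆]² = q^{N+n+1}` in type A (`σ₁θ = θ`) and `[Λ^⋆ : R^⋆]² = q^{N+n}` in type B (`σ₁θ = −θ`)**, `q = #𝓀_F = #𝓀_E` (§3: the base is totally ramified).
HONEST LABEL: HC_CM is proved only modulo the 2 remaining named inputs (hLiu418 24832, h413 24833) until rung 0 closes; unconditional commutative algebra, count-neutral.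

* §1 (any `A × B` with `⋆ = (s, t)`): `eqLocus_prodMap_toAddSubgroup_eq_prod`, `ker_prodMap_add_id_eq_prod`, `map_mulLeft_prod`, `AddSubgroup.relIndex_prod_prod`, and the product formula
  `relIndex_map_mulLeft_eqLocus_ker_prodMap` (`[Λ⁻ : (a,b)·Λ^⋆] = [A⁻ : aA^⋆]·[B⁻ : bB^⋆]`).
* §2 `relIndex_anti_fixed_prod_eq_one_typeA`, `relIndex_anti_fixed_prod_eq_natCard_typeB` (the defect of `Λ = 𝒪[E] × O₁`).
* §3 `natCard_residueField_eq_of_ramified_coord` (`#𝓀_E = #𝓀_F`).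
* §4 `star_mem_range_eval₂_iff` (`R⋆ = R`), **`relIndex_fixed_sq_eq_pow_typeA`**, **`relIndex_fixed_sq_eq_pow_typeB`**, and the parity forms `relIndex_fixed_eq_pow_typeA ∕ _typeB`.

## References
* [Neukirch1999] J. Neukirch, *Algebraic Number Theory*, Grundlehren 322 (1999): Ch. I §12 (orders, conductors, additive indices).
* [SerreLocalFields1979] J.-P. Serre, *Local Fields*, GTM 67 (1979): Ch. I §6 Prop. 17–18, Ch. V §3 (totally tamely ramified quadratic: `f = 1`, `#𝓀_E = #𝓀_F`).
* [Hungerford1974] T. W. Hungerford, *Algebra*, GTM 73 (1974): Ch. I Thm. 4.5.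
-/

set_option autoImplicit false

noncomputable section

open scoped ValuativeRel
open Polynomial ValuativeRel

namespace Literature.NumberTheory.Automorphic

open Literature.RingTheory.GaloisAlgebras

/-! ## §1 Product bookkeeping for `⋆ = (s, t)` on `A × B` -/

section ProdGeneric

variable {A B : Type*} [CommRing A] [CommRing B] (s : A →+* A) (t : B →+* B)

/-- `Λ^⋆ = A^⋆ × B^⋆` for `⋆ = (s, t)`. [cite: Hungerford1974, Ch. I Thm. 4.5] -/
theorem eqLocus_prodMap_toAddSubgroup_eq_prod :
    (RingHom.eqLocus (RingHom.prodMap s t) (RingHom.id (A × B))).toAddSubgroup =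
      ((RingHom.eqLocus s (RingHom.id A)).toAddSubgroup).prod (RingHom.eqLocus t (RingHom.id B)).toAddSubgroup := by
  ext ⟨a, b⟩
  rw [AddSubgroup.mem_prod]
  change (s a, t b) = (a, b) ↔ s a = a ∧ t b = b
  rw [Prod.mk.injEq]

/-- `Λ⁻ = A⁻ × B⁻` for `⋆ = (s, t)`. [cite: Hungerford1974, Ch. I Thm. 4.5] -/
theorem ker_prodMap_add_id_eq_prod :
    ((RingHom.prodMap s t : A × B →+* A × B).toAddMonoidHom + AddMonoidHom.id (A × B)).ker =
      ((s.toAddMonoidHom + AddMonoidHom.id A).ker).prod (t.toAddMonoidHom + AddMonoidHom.id B).ker := by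
  ext ⟨a, b⟩
  rw [AddSubgroup.mem_prod, AddMonoidHom.mem_ker, AddMonoidHom.mem_ker, AddMonoidHom.mem_ker]
  change (s a, t b) + (a, b) = 0 ↔ s a + a = 0 ∧ t b + b = 0
  rw [Prod.mk_add_mk, Prod.mk_eq_zero]

omit s t in
/-- `(a, b)·(H × K) = aH × bK`. [cite: Hungerford1974, Ch. I Thm. 4.5] -/
theorem map_mulLeft_prod (H : AddSubgroup A) (K : AddSubgroup B) (a : A) (b : B) :
    (H.prod K).map (AddMonoidHom.mulLeft ((a, b) : A × B)) = (H.map (AddMonoidHom.mulLeft a)).prod (K.map (AddMonoidHom.mulLeft b)) := by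
  ext ⟨x, y⟩
  simp only [AddSubgroup.mem_map, AddSubgroup.mem_prod, AddMonoidHom.coe_mulLeft, Prod.exists, Prod.mk_mul_mk, Prod.mk.injEq]
  constructor
  · rintro ⟨h, k, ⟨hh, hk⟩, rfl, rfl⟩
    exact ⟨⟨h, hh, rfl⟩, ⟨k, hk, rfl⟩⟩
  · rintro ⟨⟨h, hh, rfl⟩, ⟨k, hk, rfl⟩⟩
    exact ⟨h, k, ⟨hh, hk⟩, rfl, rfl⟩

omit s t in
/-- **`[K₁ × K₂ : H₁ × H₂] = [K₁ : H₁]·[K₂ : H₂]`** (relative indices of product subgroups; Mathlib `AddSubgroup.index_prod` along the subtypes). [cite: Hungerford1974, Ch. I Thm. 4.5] -/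
theorem _root_.AddSubgroup.relIndex_prod_prod {G G' : Type*} [AddGroup G] [AddGroup G'] (H₁ K₁ : AddSubgroup G) (H₂ K₂ : AddSubgroup G') :
    (H₁.prod H₂).relIndex (K₁.prod K₂) = H₁.relIndex K₁ * H₂.relIndex K₂ := by
  set f : ↥K₁ × ↥K₂ →+ G × G' := AddMonoidHom.prodMap K₁.subtype K₂.subtype with hf
  have hfapp : ∀ p : ↥K₁ × ↥K₂, f p = ((p.1 : G), (p.2 : G')) := fun _ => rfl
  have hrange : (⊤ : AddSubgroup (↥K₁ × ↥K₂)).map f = K₁.prod K₂ := by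
    ext z
    rw [AddSubgroup.mem_map, AddSubgroup.mem_prod]
    constructor
    · rintro ⟨p, -, rfl⟩
      rw [hfapp]; exact ⟨p.1.2, p.2.2⟩
    · rintro ⟨h1, h2⟩
      exact ⟨(⟨z.1, h1⟩, ⟨z.2, h2⟩), AddSubgroup.mem_top _, rfl⟩
  have hcomap : (H₁.prod H₂).comap f = (H₁.comap K₁.subtype).prod (H₂.comap K₂.subtype) := by
    ext p
    rw [AddSubgroup.mem_comap, hfapp, AddSubgroup.mem_prod, AddSubgroup.mem_prod, AddSubgroup.mem_comap, AddSubgroup.mem_comap]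
    rfl
  have h := AddSubgroup.relIndex_comap (H₁.prod H₂) f ⊤
  rw [hrange, AddSubgroup.relIndex_top_right, hcomap, AddSubgroup.index_prod] at h
  rw [← h]
  rfl

/-- **THE PRODUCT FORMULA FOR THE DEFECT**: `[Λ⁻ : (a, b)·Λ^⋆] = [A⁻ : a·A^⋆] · [B⁻ : b·B^⋆]` for `⋆ = (s, t)` on `Λ = A × B`. [cite: Hungerford1974, Ch. I Thm. 4.5] -/
theorem relIndex_map_mulLeft_eqLocus_ker_prodMap (a : A) (b : B) :
    (((RingHom.eqLocus (RingHom.prodMap s t) (RingHom.id (A × B))).toAddSubgroup).map (AddMonoidHom.mulLeft ((a, b) : A × B))).relIndex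
        ((RingHom.prodMap s t : A × B →+* A × B).toAddMonoidHom + AddMonoidHom.id (A × B)).ker =
      (((RingHom.eqLocus s (RingHom.id A)).toAddSubgroup).map (AddMonoidHom.mulLeft a)).relIndex (s.toAddMonoidHom + AddMonoidHom.id A).ker *
        (((RingHom.eqLocus t (RingHom.id B)).toAddSubgroup).map (AddMonoidHom.mulLeft b)).relIndex (t.toAddMonoidHom + AddMonoidHom.id B).ker := by
  rw [eqLocus_prodMap_toAddSubgroup_eq_prod, ker_prodMap_add_id_eq_prod, map_mulLeft_prod, AddSubgroup.relIndex_prod_prod]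

end ProdGeneric

/-! ## §2 The defect of `Λ = 𝒪[E] × O₁` in the two torus types -/

section Defect

variable {F E : Type*} [Field F] [ValuativeRel F] [Field E] [ValuativeRel E] {O₁ : Type*} [CommRing O₁]
  (ιO : 𝒪[F] →+* 𝒪[E]) (σO : 𝒪[E] →+* 𝒪[E]) (j : 𝒪[E] →+* O₁) (σ₁ : O₁ →+* O₁) (θ : O₁)
  (hcoord : ∀ z : O₁, ∃! bc : 𝒪[E] × 𝒪[E], z = j bc.1 + j bc.2 * θ)
  {ϖO : 𝒪[E]} (hcoordE : ∀ a : 𝒪[E], ∃! bc : 𝒪[F] × 𝒪[F], a = ιO bc.1 + ιO bc.2 * ϖO) (hσι : ∀ b, σO (ιO b) = ιO b) (hσϖO : σO ϖO = -ϖO)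
  (h2F : ∀ b : 𝒪[F], b * 2 = 0 → b = 0) (hσ₁j : ∀ a, σ₁ (j a) = j (σO a))

include hcoord hcoordE hσι hσϖO h2F hσ₁j in
/-- **TYPE A (`σ₁θ = θ`): `[Λ⁻ : Π·Λ^⋆] = 1`** on `Λ = 𝒪_E × O₁` (★ p846944 on `𝒪_E`, ★ p846954 on `O₁`, §1 product formula). [cite: SerreLocalFields1979, Ch. V §3] [cite: Hungerford1974, Ch. I Thm. 4.5] -/
theorem relIndex_anti_fixed_prod_eq_one_typeA (hσ₁θ : σ₁ θ = θ) :
    (((RingHom.eqLocus (RingHom.prodMap σO σ₁) (RingHom.id (𝒪[E] × O₁))).toAddSubgroup).map (AddMonoidHom.mulLeft ((ϖO, j ϖO) : 𝒪[E] × O₁))).relIndex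
        ((RingHom.prodMap σO σ₁ : 𝒪[E] × O₁ →+* 𝒪[E] × O₁).toAddMonoidHom + AddMonoidHom.id (𝒪[E] × O₁)).ker = 1 := by
  rw [relIndex_map_mulLeft_eqLocus_ker_prodMap, relIndex_map_mulLeft_eqLocus_ker_eq_one_of_coord ιO ϖO hcoordE σO hσι hσϖO h2F,
    relIndex_map_mulLeft_eqLocus_ker_eq_one_typeA ιO ϖO hcoordE σO hσι hσϖO h2F j θ hcoord σ₁ hσ₁j hσ₁θ, one_mul]

include hcoord hcoordE hσι hσϖO h2F hσ₁j in
/-- **TYPE B (`σ₁θ = −θ`): `[Λ⁻ : Π·Λ^⋆] = #𝓀_F = q`** on `Λ = 𝒪_E × O₁` (★ p846944 on `𝒪_E`, ★ (ii-b) on `O₁`; `Π² = ιO k₀`, `k₀` a uniformiser of `F`, `Π` regular).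
[cite: SerreLocalFields1979, Ch. V §3] [cite: Hungerford1974, Ch. I Thm. 4.5] -/
theorem relIndex_anti_fixed_prod_eq_natCard_typeB (hσ₁θ : σ₁ θ = -θ) {k₀F : 𝒪[F]} (hϖOsq : ϖO * ϖO = ιO k₀F) (hϖOreg : ∀ z : 𝒪[E], ϖO * z = 0 → z = 0)
    {ϖF : F} (hϖF : IsUniformizingElement ϖF) (hk₀F : valuation F (k₀F : F) = valuation F ϖF) :
    (((RingHom.eqLocus (RingHom.prodMap σO σ₁) (RingHom.id (𝒪[E] × O₁))).toAddSubgroup).map (AddMonoidHom.mulLeft ((ϖO, j ϖO) : 𝒪[E] × O₁))).relIndex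
        ((RingHom.prodMap σO σ₁ : 𝒪[E] × O₁ →+* 𝒪[E] × O₁).toAddMonoidHom + AddMonoidHom.id (𝒪[E] × O₁)).ker = Nat.card 𝓀[F] := by
  rw [relIndex_map_mulLeft_eqLocus_ker_prodMap, relIndex_map_mulLeft_eqLocus_ker_eq_one_of_coord ιO ϖO hcoordE σO hσι hσϖO h2F,
    relIndex_map_mulLeft_eqLocus_ker_eq_natCard_typeB ιO ϖO hcoordE σO hσι hσϖO h2F j θ hcoord σ₁ hσ₁j hσ₁θ hϖOsq hϖOreg hϖF hk₀F, one_mul]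

end Defect

/-! ## §3 The base is totally ramified: `#𝓀_E = #𝓀_F` -/

section Residue

variable {F E : Type*} [Field F] [ValuativeRel F] [Field E] [ValuativeRel E] (ιO : 𝒪[F] →+* 𝒪[E])
  {ϖO : 𝒪[E]} (hcoordE : ∀ a : 𝒪[E], ∃! bc : 𝒪[F] × 𝒪[F], a = ιO bc.1 + ιO bc.2 * ϖO)

include hcoordE in
/-- **`#𝓀_E = #𝓀_F` AT A TOTALLY RAMIFIED QUADRATIC BASE**: `𝒪_E = ιO𝒪_F ⊕ ιO𝒪_F·Π` with `Π` a uniformiser of `E` and `Π² = ιO k₀`, `k₀` a uniformiser of `F`; then `b ↦ ιO b (mod Π)` is onto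
`𝓀_E` with kernel `k₀𝒪_F = 𝔪_F`. [cite: SerreLocalFields1979, Ch. I §6 Prop. 17–18] -/
theorem natCard_residueField_eq_of_ramified_coord (hϖOu : IsUniformizingElement (ϖO : E)) {k₀F : 𝒪[F]} (hϖOsq : ϖO * ϖO = ιO k₀F)
    {ϖF : F} (hϖF : IsUniformizingElement ϖF) (hk₀F : valuation F (k₀F : F) = valuation F ϖF) :
    Nat.card 𝓀[E] = Nat.card 𝓀[F] := by
  classical
  have hmE : IsLocalRing.maximalIdeal 𝒪[E] = Ideal.span ({ϖO} : Set 𝒪[E]) := by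
    have h := hϖOu.span_eq
    have : (⟨(ϖO : E), hϖOu.mem⟩ : 𝒪[E]) = ϖO := Subtype.ext rfl
    rw [this] at h
    exact h
  have hmF : IsLocalRing.maximalIdeal 𝒪[F] = Ideal.span ({k₀F} : Set 𝒪[F]) := by
    rw [span_singleton_eq_span_uniformizer_pow_of_valuation_eq hϖF (N := 1) (by rw [pow_one]; exact hk₀F), pow_one]
    exact hϖF.span_eq
  -- the map `χ : 𝒪_F → 𝓀_E`, `b ↦ residue (ιO b)`
  set χ : 𝒪[F] →+* 𝓀[E] := (IsLocalRing.residue 𝒪[E]).comp ιO with hχ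
  have hsurj : Function.Surjective χ := by
    intro x
    obtain ⟨a, rfl⟩ := IsLocalRing.residue_surjective x
    obtain ⟨⟨b, c⟩, rfl, -⟩ := hcoordE a
    refine ⟨b, ?_⟩
    rw [hχ, RingHom.comp_apply, ← sub_eq_zero, ← map_sub, IsLocalRing.residue_eq_zero_iff, hmE, Ideal.mem_span_singleton']
    exact ⟨-ιO c, by ring⟩
  have hker : RingHom.ker χ = IsLocalRing.maximalIdeal 𝒪[F] := by
    ext b
    rw [RingHom.mem_ker, hχ, RingHom.comp_apply, IsLocalRing.residue_eq_zero_iff, hmE, hmF, Ideal.mem_span_singleton', Ideal.mem_span_singleton']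
    constructor
    · rintro ⟨a, ha⟩
      obtain ⟨⟨b', c'⟩, rfl, -⟩ := hcoordE a
      -- `(ιO b' + ιO c' Π)·Π = ιO (c' k₀) + ιO b' Π`
      have h' : ιO (c' * k₀F) + ιO b' * ϖO = ιO b + ιO 0 * ϖO := by
        rw [map_zero, zero_mul, add_zero, ← ha, map_mul, ← hϖOsq]; ring
      obtain ⟨hb, -⟩ := coord_unique ιO ϖO hcoordE h'
      exact ⟨c', hb⟩
    · rintro ⟨c', rfl⟩
      exact ⟨ιO c' * ϖO, by rw [map_mul, ← hϖOsq]; ring⟩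
  unfold IsLocalRing.ResidueField
  rw [← hker]
  exact (Nat.card_congr (RingHom.quotientKerEquivOfSurjective hsurj).toEquiv).symm

end Residue

/-! ## §4 The defective descent assembled: `[Λ^⋆ : R^⋆]` -/

section Descent

variable {F E : Type*} [Field F] [ValuativeRel F] [Field E] [ValuativeRel E] {O₁ : Type*} [CommRing O₁]
  (ιO : 𝒪[F] →+* 𝒪[E]) (σO : 𝒪[E] →+* 𝒪[E]) (j : 𝒪[E] →+* O₁) (σ₁ : O₁ →+* O₁) (θ : O₁) {k₀ : 𝒪[E]}
  (u : 𝒪[E]) {t y D e₂ : 𝒪[E]} {lam : O₁} {ϖ : E} {n N : ℕ}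
  [IsDiscreteValuationRing 𝒪[E]]
  (hθ : θ ^ 2 = j k₀) (hcoord : ∀ z : O₁, ∃! bc : 𝒪[E] × 𝒪[E], z = j bc.1 + j bc.2 * θ)
  (h2 : e₂ * 2 = 1) (hD : 4 * D = t * t - y * y * k₀) (hlam : lam = j (e₂ * t) + j (e₂ * y) * θ) (hϖ : IsUniformizingElement ϖ)
  (hn : valuation E ((u * u - t * u + D : 𝒪[E]) : E) = valuation E ϖ ^ n) (hN : valuation E ((y : 𝒪[E]) : E) = valuation E ϖ ^ N)
  (hσσ : ∀ a, σO (σO a) = a) (hσ₁σ₁ : ∀ z, σ₁ (σ₁ z) = z) (hσ₁j : ∀ a, σ₁ (j a) = j (σO a))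
  (hx1 : ((u, lam) : 𝒪[E] × O₁) * RingHom.prodMap σO σ₁ (u, lam) = 1) (huD : IsUnit (u * D))
  {ϖO : 𝒪[E]} (hcoordE : ∀ a : 𝒪[E], ∃! bc : 𝒪[F] × 𝒪[F], a = ιO bc.1 + ιO bc.2 * ϖO) (hσι : ∀ b, σO (ιO b) = ιO b) (hσϖO : σO ϖO = -ϖO)
  (h2F : ∀ b : 𝒪[F], b * 2 = 0 → b = 0) (hϖOu : IsUniformizingElement (ϖO : E))
  {k₀F : 𝒪[F]} (hϖOsq : ϖO * ϖO = ιO k₀F) {ϖF : F} (hϖF : IsUniformizingElement ϖF) (hk₀F : valuation F (k₀F : F) = valuation F ϖF)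

omit [IsDiscreteValuationRing 𝒪[E]] in
include hθ h2 hD hlam hσσ hσ₁σ₁ hσ₁j hx1 huD in
/-- **`R⋆ = R`**: `⋆r ∈ R ↔ r ∈ R` for `R = 𝒪_E[x]` (`⋆` is `σO` on constants and swaps `x ↔ x⋆ = x⁻¹ ∈ R`; the unramified-`O₁` companion of ★ `star_mem_range_eval₂`, whose
hypotheses require `θ² ∈ 𝔪`). [cite: Neukirch1999, Ch. I §12] -/
theorem star_mem_range_eval₂_iff (r : 𝒪[E] × O₁) :
    RingHom.prodMap σO σ₁ r ∈ (Polynomial.eval₂RingHom (RingHom.prod (RingHom.id 𝒪[E]) j) ((u, lam) : 𝒪[E] × O₁)).range ↔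
      r ∈ (Polynomial.eval₂RingHom (RingHom.prod (RingHom.id 𝒪[E]) j) ((u, lam) : 𝒪[E] × O₁)).range := by
  set R := (Polynomial.eval₂RingHom (RingHom.prod (RingHom.id 𝒪[E]) j) ((u, lam) : 𝒪[E] × O₁)).range with hR
  have hstκ : ∀ c, RingHom.prodMap σO σ₁ (RingHom.prod (RingHom.id 𝒪[E]) j c) = RingHom.prod (RingHom.id 𝒪[E]) j (σO c) := star_const σO j σ₁ hσ₁j
  have hstst := star_inv_gen σO σ₁ hσσ hσ₁σ₁
  have key : ∀ r' ∈ R, RingHom.prodMap σO σ₁ r' ∈ R := by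
    intro r' hr'
    obtain ⟨d, rfl⟩ := exists_inv_coord_of_mem_range j θ u hθ h2 hD hlam hx1 hr'
    rw [map_add, map_add, map_mul, map_mul, hstκ, hstκ, hstκ, hstst]
    exact R.add_mem (R.add_mem (const_mem_range_eval₂ j u _) (R.mul_mem (const_mem_range_eval₂ j u _) (inv_gen_mem_range_eval₂ j θ u hθ h2 hD hlam huD hx1)))
      (R.mul_mem (const_mem_range_eval₂ j u _) (gen_mem_range_eval₂ j u))
  refine ⟨fun h => ?_, key r⟩
  have := key _ h
  rwa [hstst] at this

include hθ hcoord h2 hD hlam hϖ hn hN hσσ hσ₁σ₁ hσ₁j hx1 huD hcoordE hσι hσϖO h2F in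
/-- THE DEFECTIVE DESCENT AT `Λ = 𝒪_E × O₁`: `q_E^{N+n} · q_E = [Λ^⋆ : R^⋆]² · [Λ⁻ : Π·Λ^⋆]` (★ p846932 with `h = (e₂, je₂)`, `π = (Π, jΠ)`; ★ p846557 `[Λ : R] = q_E^{N+n}`; ★ p847012
`[R⁻ : ΠR^⋆] = q_E`). [cite: Neukirch1999, Ch. I §12] [cite: Hungerford1974, Ch. I Thm. 4.5] -/
theorem pow_mul_natCard_eq_relIndex_fixed_sq_mul (hϖOv : valuation E ((ϖO : 𝒪[E]) : E) = valuation E ϖ) :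
    Nat.card 𝓀[E] ^ (N + n) * Nat.card 𝓀[E] =
      ((Polynomial.eval₂RingHom (RingHom.prod (RingHom.id 𝒪[E]) j) ((u, lam) : 𝒪[E] × O₁)).range.toAddSubgroup.relIndex
          (RingHom.eqLocus (RingHom.prodMap σO σ₁) (RingHom.id (𝒪[E] × O₁))).toAddSubgroup) ^ 2 *
        (((RingHom.eqLocus (RingHom.prodMap σO σ₁) (RingHom.id (𝒪[E] × O₁))).toAddSubgroup).map (AddMonoidHom.mulLeft ((ϖO, j ϖO) : 𝒪[E] × O₁))).relIndex
          ((RingHom.prodMap σO σ₁ : 𝒪[E] × O₁ →+* 𝒪[E] × O₁).toAddMonoidHom + AddMonoidHom.id (𝒪[E] × O₁)).ker := by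
  set R := (Polynomial.eval₂RingHom (RingHom.prod (RingHom.id 𝒪[E]) j) ((u, lam) : 𝒪[E] × O₁)).range with hR
  set st : 𝒪[E] × O₁ →+* 𝒪[E] × O₁ := RingHom.prodMap σO σ₁ with hst
  have hstar : ∀ z, st (st z) = z := star_inv_gen σO σ₁ hσσ hσ₁σ₁
  have hh : ((e₂, j e₂) : 𝒪[E] × O₁) * 2 = 1 := by
    refine Prod.ext ?_ ?_
    · simpa using h2
    · change j e₂ * 2 = 1
      rw [← map_ofNat j 2, ← map_mul, h2, map_one]
  have hπs : st ((ϖO, j ϖO) : 𝒪[E] × O₁) = -((ϖO, j ϖO) : 𝒪[E] × O₁) := by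
    change (σO ϖO, σ₁ (j ϖO)) = -(ϖO, j ϖO)
    rw [hσ₁j, hσϖO, map_neg, Prod.neg_mk]
  have hϖO0 : ϖO ≠ 0 := by
    intro h0
    have h' := hϖOv
    rw [h0, ZeroMemClass.coe_zero, map_zero] at h'
    exact ((Valuation.ne_zero_iff _).2 hϖ.ne_zero) h'.symm
  have hπ : ∀ z : 𝒪[E] × O₁, ((ϖO, j ϖO) : 𝒪[E] × O₁) * z = 0 → z = 0 := by
    rintro ⟨a, w⟩ h
    rw [Prod.mk_mul_mk, Prod.mk_eq_zero] at h
    obtain ⟨ha, hw⟩ := h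
    obtain ⟨⟨b, c⟩, rfl, -⟩ := hcoord w
    have h' : j (ϖO * b) + j (ϖO * c) * θ = j 0 + j 0 * θ := by
      rw [map_zero, zero_mul, add_zero, map_mul, map_mul, ← hw]; ring
    obtain ⟨hb, hc⟩ := coord_unique j θ hcoord h'
    refine Prod.ext ?_ ?_
    · change a = 0
      exact mul_left_cancel₀ hϖO0 (by rw [ha, mul_zero])
    change j b + j c * θ = 0
    rw [mul_left_cancel₀ hϖO0 (by rw [hb, mul_zero] : ϖO * b = ϖO * 0), mul_left_cancel₀ hϖO0 (by rw [hc, mul_zero] : ϖO * c = ϖO * 0),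
      map_zero, zero_mul, add_zero]
  have hsR : ∀ r ∈ R, st r ∈ R := fun r hr => (star_mem_range_eval₂_iff σO j σ₁ θ u hθ h2 hD hlam hσσ hσ₁σ₁ hσ₁j hx1 huD r).2 hr
  have key := index_mul_relIndex_map_eq_sq_mul st hstar hh hπs hπ R hsR (const_mem_range_eval₂ j u e₂) (const_mem_range_eval₂ j u ϖO)
  rw [index_range_eval₂_eq_pow j θ hθ hcoord u h2 hD hlam hϖ hn hN,
    relIndex_map_mulLeft_fixed_anti_eq_natCard ιO σO j σ₁ θ u hθ hcoord h2 hD hlam hϖ hn hN hσσ hσ₁σ₁ hσ₁j hx1 huD hcoordE hσι hσϖO h2F hϖOv] at key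
  exact key

include hθ hcoord h2 hD hlam hϖ hn hN hσσ hσ₁σ₁ hσ₁j hx1 huD hcoordE hσι hσϖO h2F hϖOu hϖOsq hϖF hk₀F in
/-- **TYPE A (`σ₁θ = θ`): `[Λ^⋆ : R^⋆]² = q^{N+n+1}`**, `q = #𝓀_F` (defect `1`, ★ §2; `#𝓀_E = #𝓀_F`, §3).  A-p19 CERT «[T2-c]-ram» §2: «Type A ⇒ `[Λ^⋆ : R^⋆] = q^{(m+1)∕2}`».
[cite: Neukirch1999, Ch. I §12] [cite: SerreLocalFields1979, Ch. V §3] -/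
theorem relIndex_fixed_sq_eq_pow_typeA (hϖOv : valuation E ((ϖO : 𝒪[E]) : E) = valuation E ϖ) (hσ₁θ : σ₁ θ = θ) :
    ((Polynomial.eval₂RingHom (RingHom.prod (RingHom.id 𝒪[E]) j) ((u, lam) : 𝒪[E] × O₁)).range.toAddSubgroup.relIndex
        (RingHom.eqLocus (RingHom.prodMap σO σ₁) (RingHom.id (𝒪[E] × O₁))).toAddSubgroup) ^ 2 = Nat.card 𝓀[F] ^ (N + n + 1) := by
  have key := pow_mul_natCard_eq_relIndex_fixed_sq_mul ιO σO j σ₁ θ u hθ hcoord h2 hD hlam hϖ hn hN hσσ hσ₁σ₁ hσ₁j hx1 huD hcoordE hσι hσϖO h2F hϖOv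
  rw [relIndex_anti_fixed_prod_eq_one_typeA ιO σO j σ₁ θ hcoord hcoordE hσι hσϖO h2F hσ₁j hσ₁θ, mul_one,
    natCard_residueField_eq_of_ramified_coord ιO hcoordE hϖOu hϖOsq hϖF hk₀F, ← pow_succ] at key
  exact key.symm

include hθ hcoord h2 hD hlam hϖ hn hN hσσ hσ₁σ₁ hσ₁j hx1 huD hcoordE hσι hσϖO h2F hϖOu hϖOsq hϖF hk₀F in
/-- **TYPE B (`σ₁θ = −θ`): `[Λ^⋆ : R^⋆]² = q^{N+n}`**, `q = #𝓀_F` (defect `q`, ★ §2).  A-p19 CERT «[T2-c]-ram» §2: «Type B ⇒ `[Λ : R] = [Λ^⋆ : R^⋆]²`».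
[cite: Neukirch1999, Ch. I §12] [cite: SerreLocalFields1979, Ch. V §3] -/
theorem relIndex_fixed_sq_eq_pow_typeB [Finite 𝓀[F]] (hϖOv : valuation E ((ϖO : 𝒪[E]) : E) = valuation E ϖ) (hσ₁θ : σ₁ θ = -θ) :
    ((Polynomial.eval₂RingHom (RingHom.prod (RingHom.id 𝒪[E]) j) ((u, lam) : 𝒪[E] × O₁)).range.toAddSubgroup.relIndex
        (RingHom.eqLocus (RingHom.prodMap σO σ₁) (RingHom.id (𝒪[E] × O₁))).toAddSubgroup) ^ 2 = Nat.card 𝓀[F] ^ (N + n) := by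
  have key := pow_mul_natCard_eq_relIndex_fixed_sq_mul ιO σO j σ₁ θ u hθ hcoord h2 hD hlam hϖ hn hN hσσ hσ₁σ₁ hσ₁j hx1 huD hcoordE hσι hσϖO h2F hϖOv
  have hϖO0 : ϖO ≠ 0 := by
    intro h0
    have h' := hϖOv
    rw [h0, ZeroMemClass.coe_zero, map_zero] at h'
    exact ((Valuation.ne_zero_iff _).2 hϖ.ne_zero) h'.symm
  have hreg : ∀ z : 𝒪[E], ϖO * z = 0 → z = 0 := fun z hz => mul_left_cancel₀ hϖO0 (by rw [hz, mul_zero])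
  rw [relIndex_anti_fixed_prod_eq_natCard_typeB ιO σO j σ₁ θ hcoord hcoordE hσι hσϖO h2F hσ₁j hσ₁θ hϖOsq hreg hϖF hk₀F,
    natCard_residueField_eq_of_ramified_coord ιO hcoordE hϖOu hϖOsq hϖF hk₀F] at key
  have hq : 0 < Nat.card 𝓀[F] := Nat.card_pos
  exact (Nat.eq_of_mul_eq_mul_right hq key).symm

include hθ hcoord h2 hD hlam hϖ hn hN hσσ hσ₁σ₁ hσ₁j hx1 huD hcoordE hσι hσϖO h2F hϖOu hϖOsq hϖF hk₀F in
/-- **TYPE A with `N + n` ODD: `[Λ^⋆ : R^⋆] = q^{(N+n+1)∕2}`** (the parity is the CERT's law «type A ⟺ `N` odd, `n` even», carried as a hypothesis). [cite: Neukirch1999, Ch. I §12] -/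
theorem relIndex_fixed_eq_pow_typeA (hϖOv : valuation E ((ϖO : 𝒪[E]) : E) = valuation E ϖ) (hσ₁θ : σ₁ θ = θ) (hm : Odd (N + n)) :
    (Polynomial.eval₂RingHom (RingHom.prod (RingHom.id 𝒪[E]) j) ((u, lam) : 𝒪[E] × O₁)).range.toAddSubgroup.relIndex
        (RingHom.eqLocus (RingHom.prodMap σO σ₁) (RingHom.id (𝒪[E] × O₁))).toAddSubgroup = Nat.card 𝓀[F] ^ ((N + n + 1) / 2) := by
  have key := relIndex_fixed_sq_eq_pow_typeA ιO σO j σ₁ θ u hθ hcoord h2 hD hlam hϖ hn hN hσσ hσ₁σ₁ hσ₁j hx1 huD hcoordE hσι hσϖO h2F hϖOu hϖOsq hϖF hk₀F hϖOv hσ₁θ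
  obtain ⟨k, hk⟩ := hm
  have he : N + n + 1 = 2 * ((N + n + 1) / 2) := by omega
  rw [he, pow_mul'] at key
  exact Nat.pow_left_injective two_ne_zero key

include hθ hcoord h2 hD hlam hϖ hn hN hσσ hσ₁σ₁ hσ₁j hx1 huD hcoordE hσι hσϖO h2F hϖOu hϖOsq hϖF hk₀F in
/-- **TYPE B with `N + n` EVEN: `[Λ^⋆ : R^⋆] = q^{(N+n)∕2}`** (parity carried as a hypothesis: CERT «type B ⟺ `N` even»). [cite: Neukirch1999, Ch. I §12] -/
theorem relIndex_fixed_eq_pow_typeB [Finite 𝓀[F]] (hϖOv : valuation E ((ϖO : 𝒪[E]) : E) = valuation E ϖ) (hσ₁θ : σ₁ θ = -θ) (hm : Even (N + n)) :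
    (Polynomial.eval₂RingHom (RingHom.prod (RingHom.id 𝒪[E]) j) ((u, lam) : 𝒪[E] × O₁)).range.toAddSubgroup.relIndex
        (RingHom.eqLocus (RingHom.prodMap σO σ₁) (RingHom.id (𝒪[E] × O₁))).toAddSubgroup = Nat.card 𝓀[F] ^ ((N + n) / 2) := by
  have key := relIndex_fixed_sq_eq_pow_typeB ιO σO j σ₁ θ u hθ hcoord h2 hD hlam hϖ hn hN hσσ hσ₁σ₁ hσ₁j hx1 huD hcoordE hσι hσϖO h2F hϖOu hϖOsq hϖF hk₀F hϖOv hσ₁θ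
  obtain ⟨k, hk⟩ := hm
  have he : N + n = 2 * ((N + n) / 2) := by omega
  rw [he, pow_mul'] at key
  exact Nat.pow_left_injective two_ne_zero key

end Descent

end Literature.NumberTheory.Automorphic

end
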